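import Summits.BirchSwinnertonDyer.BirchSwinnertonDyer.Theorems.UniversalToricDescentResidualGrowthSelmerSide
import Summits.BirchSwinnertonDyer.BirchSwinnertonDyer.Theorems.UniversalToricDescentEisensteinSpecializationRank
import Summits.BirchSwinnertonDyer.BirchSwinnertonDyer.Theorems.UniversalToricDescentTwoSidedMuTransferPackageMu
import Literature.NumberTheory.EllipticCurves.IwasawaAlgebraSpecializationIndexProofs
import HarnessLib

/-!
# Route UniversalToricDescent — K2∣β FROM A SPECIALISED INDEX INEQUALITY at Howard's primes `q_m = T^m + p`
# (the x10b template `HeegnerMuPartStabilizedOfSpecializedIndex` / `PrintX10bBeyondCarrierOfSpecializedIndex` transplanted to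
# the port stub `stub_residualCorankLeOneMultOfBeta` of line `beta-road` v7 on crux `TwinAlgMuZeroAtThree`, stmt-BirchSwinnertonDyer-24737)

Width prover `bsd-wall-utd-p1-w2` g11 under lead `bsd-wall-utd-p1` g23 (`--supports stmt-BirchSwinnertonDyer-24737`, helper; brick E5/E6
glue of the lead's `STUB-BRIEF-K2beta-v7`). THEOREMS ONLY (no definition, no named fact, no `sorry`); no `Theses` import. BSD is not
proved by any of this; 24737 stays OPEN. HONEST FRAMING: the hypothesis `hKS` below — the Kolyvagin-system bound SPECIALISED at the DVRs
`Λ/q_m = ℤ_p[π]` (`π^m = −p`), uniform in `m` — is ARITHMETIC and is NOT in print at `3 ∥ N′` (it is what E1–E4 of the brief, i.e.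
Howard 2004 Thm. 1.6.1 (iii) over `S_{q_m}` for the Tate-line Selmer structure plus the control terms E3, deliver; rows 9/10 of cell
`bsd-print-x9` share the same currency `hKS`); this file does not claim it.

* §1 (pure `Λ`-algebra) `muInvariant_torsion_eq_zero_of_card_quotSMulTop_qm_le`: `X` finitely generated, `N′` finitely generated torsion
  with `μ(N′) = 0`, and `hKS : ∃ C m₀, ∀ m ≥ m₀, #(X_tors ⧸ q_m X_tors) ≤ p^C · #(N′ ⧸ q_m N′)²` ⟹ `μ(X_tors) = 0` (one call of the tree's
  `IwasawaAlgebra.muInvariant_le_two_mul_of_card_quotSMulTop_qm_le`: `μ(X_tors) ≤ 2·μ(N′)`); and the E6 form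
  `muInvariant_torsion_eq_zero_of_card_quotSMulTop_qm_le_of_not_mem` with `N′ = 𝔖 ⧸ Λκ` for `𝔖` finitely generated torsion-free of
  `Λ`-rank one, `loc : 𝔖 →ₗ Λ` and `loc κ ∉ pΛ` (K1's `μ`-shadow: `μ(𝔖/Λκ) = 0`, tree
  `…TwoSidedMuTransfer.muInvariant_quotient_span_eq_zero_of_not_mem_augIdealP`).
* §2 (Selmer side, any `p`) `exists_natCard_fixedPTorsion_le_of_card_quotSMulTop_qm_le[_of_not_mem]`: for any Pontryagin-dual datum `D` of
  `Sel_{p^∞}(E/K_∞)` with `X = D.X` finitely generated of `finrank ≤ 1`: `hKS` (+ `μ(N′) = 0` | `loc κ ∉ pΛ`) ⟹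
  `∃ C, ∀ n, #{s ∈ Sel_∞ : p·s = 0, conj_{γ^{pⁿ}} s = s} ≤ p^{pⁿ + C}` (through p747307 `…ResidualGrowthSelmerSide`).
* §3 (`p = 3`) `k2ResBound_of_card_quotSMulTop_qm_le[_of_not_mem]`: the conclusion of `stub_residualCorankLeOneMultOfBeta` VERBATIM. So the
  port's remaining deliverables are pinned BY NAME: «`finrank_Λ X(E′/K_∞) ≤ 1`» (Howard Thm. B (a)-shape) ∧ `hKS(X_tors, 𝔖/Λκ₁)`
  ∧ K1's shadow «`loc_𝔭 κ₁ ∉ 3Λ`».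
* §4 (`p = 3`, EVERYTHING SPECIALISED) `k2ResBound_of_specialized`: the rank input too is read at the Eisenstein primes —
  `hrank : ∀ m₀, ∃ m ≥ m₀, rank_{ℤ₃} X/q_m X ≤ m + C` (Howard Thm. 1.6.1 (i)–(ii) over `S_m` after control; tree
  `…EisensteinSpecializationRank.finrank_le_one_of_lambdaInvariant_quotient_X_pow_add_C_le`) ∧ `hKS` ∧ «`loc κ₁ ∉ 3Λ`» ⟹ the stub's conclusion.

References: [Howard2004HeegnerKolyvagin] Thm. B and proof of Thm. 2.2.10 (arXiv:1202.6340 p. 18, «taking 𝔮 = T^m + p»); [MazurRubin2004] §5.3;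
[Washington1997] §13.2; [Castella2017HeegnerBeilinsonFlach] App. A (A.4).
-/

set_option linter.dupNamespace false
set_option autoImplicit false

noncomputable section

open scoped Classical

namespace Summit.BirchSwinnertonDyer.BirchSwinnertonDyer.Theorems.UniversalToricDescentK2BetaOfSpecializedIndex

open Literature.NumberTheory.EllipticCurves Literature.NumberTheory.EllipticCurves.IwasawaAlgebra
  Summit.BirchSwinnertonDyer.BirchSwinnertonDyer.Theorems.UniversalToricDescentResidualGrowthSelmerSide
  Summit.BirchSwinnertonDyer.BirchSwinnertonDyer.Theorems.UniversalToricDescentTwoSidedMuTransfer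

/-! ## §1 `hKS ∧ μ(N′) = 0 ⟹ μ(X_tors) = 0` -/

section Lambda

variable {p : ℕ} [Fact p.Prime]
variable {M : Type*} [AddCommGroup M] [Module (IwasawaAlgebra p) M]

/-- **Specialised index inequality + `μ(N′) = 0` ⟹ `μ(X_tors) = 0`.** For `X` finitely generated over `Λ = ℤ_p⟦T⟧`, `N′` finitely generated
torsion with `μ(N′) = 0`, and a uniform inequality `#(X_tors ⧸ q_m X_tors) ≤ p^C · #(N′ ⧸ q_m N′)²` for all large `m` (`q_m = T^m + p`):
`μ(X_tors) ≤ 2·μ(N′) = 0` (tree `IwasawaAlgebra.muInvariant_le_two_mul_of_card_quotSMulTop_qm_le`).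
[cite: Howard2004HeegnerKolyvagin, proof of Thm. 2.2.10] [cite: Washington1997, §13.2] -/
theorem muInvariant_torsion_eq_zero_of_card_quotSMulTop_qm_le [Module.Finite (IwasawaAlgebra p) M]
    {N' : Type*} [AddCommGroup N'] [Module (IwasawaAlgebra p) N'] [Module.Finite (IwasawaAlgebra p) N']
    (hN' : Module.IsTorsion (IwasawaAlgebra p) N') (hμ' : muInvariant p N' = 0)
    (hKS : ∃ C m₀ : ℕ, ∀ m : ℕ, m₀ ≤ m →
      Nat.card (↥(Submodule.torsion (IwasawaAlgebra p) M) ⧸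
        (Ideal.span {(PowerSeries.X ^ m + PowerSeries.C (p : ℤ_[p]) : IwasawaAlgebra p)} • ⊤ :
          Submodule (IwasawaAlgebra p) ↥(Submodule.torsion (IwasawaAlgebra p) M))) ≤
      p ^ C * Nat.card (N' ⧸ (Ideal.span {(PowerSeries.X ^ m + PowerSeries.C (p : ℤ_[p]) : IwasawaAlgebra p)} • ⊤ :
          Submodule (IwasawaAlgebra p) N')) ^ 2) :
    muInvariant p (Submodule.torsion (IwasawaAlgebra p) M) = 0 := by
  haveI : IsNoetherian (IwasawaAlgebra p) M := isNoetherian_of_isNoetherianRing_of_finite _ _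
  haveI : Module.Finite (IwasawaAlgebra p) ↥(Submodule.torsion (IwasawaAlgebra p) M) :=
    Module.Finite.iff_fg.mpr (IsNoetherian.noetherian _)
  have hle := muInvariant_le_two_mul_of_card_quotSMulTop_qm_le p
    (↥(Submodule.torsion (IwasawaAlgebra p) M)) N' (Submodule.torsion_isTorsion) hN' hKS
  rw [hμ'] at hle
  exact Nat.le_zero.mp hle

/-- **The E6 form: specialised index inequality against `𝔖 ⧸ Λκ` with `loc κ ∉ pΛ` ⟹ `μ(X_tors) = 0`.** For `𝔖` finitely generated,
torsion-free of `Λ`-rank one, a linear `loc : 𝔖 → Λ` and `κ ∈ 𝔖` with `loc κ ∉ pΛ` (K1's `μ`-shadow, giving `μ(𝔖/Λκ) = 0` by the tree's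
`muInvariant_quotient_span_eq_zero_of_not_mem_augIdealP`), a uniform inequality `#(X_tors ⧸ q_m X_tors) ≤ p^C · #((𝔖/Λκ) ⧸ q_m)²` for all
large `m` forces `μ(X_tors) = 0`. [cite: Howard2004HeegnerKolyvagin, Thm. B, proof of Thm. 2.2.10]
[cite: Castella2017HeegnerBeilinsonFlach, App. A (A.4)] -/
theorem muInvariant_torsion_eq_zero_of_card_quotSMulTop_qm_le_of_not_mem [Module.Finite (IwasawaAlgebra p) M]
    {S : Type*} [AddCommGroup S] [Module (IwasawaAlgebra p) S] [Module.Finite (IwasawaAlgebra p) S]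
    [NoZeroSMulDivisors (IwasawaAlgebra p) S]
    (hS1 : Module.finrank (IwasawaAlgebra p) S = 1) (κ : S)
    (loc : S →ₗ[IwasawaAlgebra p] IwasawaAlgebra p) (hβ : loc κ ∉ augIdealP p)
    (hKS : ∃ C m₀ : ℕ, ∀ m : ℕ, m₀ ≤ m →
      Nat.card (↥(Submodule.torsion (IwasawaAlgebra p) M) ⧸
        (Ideal.span {(PowerSeries.X ^ m + PowerSeries.C (p : ℤ_[p]) : IwasawaAlgebra p)} • ⊤ :
          Submodule (IwasawaAlgebra p) ↥(Submodule.torsion (IwasawaAlgebra p) M))) ≤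
      p ^ C * Nat.card ((S ⧸ Submodule.span (IwasawaAlgebra p) {κ}) ⧸
        (Ideal.span {(PowerSeries.X ^ m + PowerSeries.C (p : ℤ_[p]) : IwasawaAlgebra p)} • ⊤ :
          Submodule (IwasawaAlgebra p) (S ⧸ Submodule.span (IwasawaAlgebra p) {κ}))) ^ 2) :
    muInvariant p (Submodule.torsion (IwasawaAlgebra p) M) = 0 := by
  have hloc0 : loc κ ≠ 0 := fun h => hβ (h ▸ Submodule.zero_mem _)
  have hκ0 : κ ≠ 0 := fun h => hloc0 (by rw [h, map_zero])
  have hT : Module.IsTorsion (IwasawaAlgebra p) (S ⧸ Submodule.span (IwasawaAlgebra p) {κ}) :=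
    isTorsion_quotient_span_of_finrank_eq_one hS1 hκ0
  have hμ' := (muInvariant_quotient_span_eq_zero_of_not_mem_augIdealP hS1 κ loc hβ).1
  exact muInvariant_torsion_eq_zero_of_card_quotSMulTop_qm_le hT hμ' hKS

end Lambda

/-! ## §2 The Selmer side -/

section Selmer

open WeierstrassCurve

universe u

variable {K : Type u} [Field K] [NumberField K] {W : WeierstrassCurve K} {p : ℕ} [Fact p.Prime]
  {κ : ZpExtension K p} {γ : Field.absoluteGaloisGroup K}

/-- **`finrank ≤ 1 ∧ hKS ∧ μ(N′) = 0 ⟹ #Sel_∞[p]^{γ^{pⁿ}} ≤ p^{pⁿ + C}`.** For any Pontryagin-dual datum `D` of `Sel_{p^∞}(E/K_∞)` over `(κ, γ)`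
with `X = D.X` finitely generated of `Λ`-rank `≤ 1`, any finitely generated torsion `N′` with `μ(N′) = 0`, and the specialised index
inequality `hKS` for `(X_tors, N′)`: `∃ C, ∀ n, #{s ∈ Sel_∞ : p·s = 0, conj_{γ^{pⁿ}} s = s} ≤ p^{pⁿ + C}` (§1 + p747307
`…ResidualGrowthSelmerSide.exists_natCard_fixedPTorsion_le_of_finrank_le_one`). [cite: Howard2004HeegnerKolyvagin, Thm. B]
[cite: GreenbergLNM1716, §1 p. 60] -/
theorem exists_natCard_fixedPTorsion_le_of_card_quotSMulTop_qm_le (D : W.SelmerDualData κ γ)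
    [Module.Finite (IwasawaAlgebra p) D.X] (h1 : Module.finrank (IwasawaAlgebra p) D.X ≤ 1)
    {N' : Type*} [AddCommGroup N'] [Module (IwasawaAlgebra p) N'] [Module.Finite (IwasawaAlgebra p) N']
    (hN' : Module.IsTorsion (IwasawaAlgebra p) N') (hμ' : muInvariant p N' = 0)
    (hKS : ∃ C m₀ : ℕ, ∀ m : ℕ, m₀ ≤ m →
      Nat.card (↥(Submodule.torsion (IwasawaAlgebra p) D.X) ⧸
        (Ideal.span {(PowerSeries.X ^ m + PowerSeries.C (p : ℤ_[p]) : IwasawaAlgebra p)} • ⊤ :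
          Submodule (IwasawaAlgebra p) ↥(Submodule.torsion (IwasawaAlgebra p) D.X))) ≤
      p ^ C * Nat.card (N' ⧸ (Ideal.span {(PowerSeries.X ^ m + PowerSeries.C (p : ℤ_[p]) : IwasawaAlgebra p)} • ⊤ :
          Submodule (IwasawaAlgebra p) N')) ^ 2) :
    ∃ C : ℕ, ∀ n : ℕ,
      Nat.card {s : W.selmerInfty κ // p • s = 0 ∧
        W.conjH1 p κ.kerSubgroup (γ ^ p ^ n) (s : W.subgroupH1 p κ.kerSubgroup) = s} ≤ p ^ (p ^ n + C) :=
  exists_natCard_fixedPTorsion_le_of_finrank_le_one D h1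
    (muInvariant_torsion_eq_zero_of_card_quotSMulTop_qm_le hN' hμ' hKS)

/-- **`finrank ≤ 1 ∧ hKS(X_tors, 𝔖/Λκ) ∧ loc κ ∉ pΛ ⟹ #Sel_∞[p]^{γ^{pⁿ}} ≤ p^{pⁿ + C}`** — the E6 form (`𝔖` finitely generated torsion-free
of `Λ`-rank one, `loc : 𝔖 →ₗ Λ`, `loc κ ∉ pΛ`). [cite: Howard2004HeegnerKolyvagin, Thm. B] [cite: Castella2017HeegnerBeilinsonFlach, App. A (A.4)] -/
theorem exists_natCard_fixedPTorsion_le_of_card_quotSMulTop_qm_le_of_not_mem (D : W.SelmerDualData κ γ)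
    [Module.Finite (IwasawaAlgebra p) D.X] (h1 : Module.finrank (IwasawaAlgebra p) D.X ≤ 1)
    {S : Type*} [AddCommGroup S] [Module (IwasawaAlgebra p) S] [Module.Finite (IwasawaAlgebra p) S]
    [NoZeroSMulDivisors (IwasawaAlgebra p) S]
    (hS1 : Module.finrank (IwasawaAlgebra p) S = 1) (κ₁ : S)
    (loc : S →ₗ[IwasawaAlgebra p] IwasawaAlgebra p) (hβ : loc κ₁ ∉ augIdealP p)
    (hKS : ∃ C m₀ : ℕ, ∀ m : ℕ, m₀ ≤ m →
      Nat.card (↥(Submodule.torsion (IwasawaAlgebra p) D.X) ⧸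
        (Ideal.span {(PowerSeries.X ^ m + PowerSeries.C (p : ℤ_[p]) : IwasawaAlgebra p)} • ⊤ :
          Submodule (IwasawaAlgebra p) ↥(Submodule.torsion (IwasawaAlgebra p) D.X))) ≤
      p ^ C * Nat.card ((S ⧸ Submodule.span (IwasawaAlgebra p) {κ₁}) ⧸
        (Ideal.span {(PowerSeries.X ^ m + PowerSeries.C (p : ℤ_[p]) : IwasawaAlgebra p)} • ⊤ :
          Submodule (IwasawaAlgebra p) (S ⧸ Submodule.span (IwasawaAlgebra p) {κ₁}))) ^ 2) :
    ∃ C : ℕ, ∀ n : ℕ,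
      Nat.card {s : W.selmerInfty κ // p • s = 0 ∧
        W.conjH1 p κ.kerSubgroup (γ ^ p ^ n) (s : W.subgroupH1 p κ.kerSubgroup) = s} ≤ p ^ (p ^ n + C) :=
  exists_natCard_fixedPTorsion_le_of_finrank_le_one D h1
    (muInvariant_torsion_eq_zero_of_card_quotSMulTop_qm_le_of_not_mem hS1 κ₁ loc hβ hKS)

end Selmer

/-! ## §3 The conclusion of K2∣β VERBATIM -/

section K2

open WeierstrassCurve

/-- **K2∣β from «`finrank ≤ 1` ∧ `hKS` ∧ `μ(N′) = 0`».** For `E′ = W′/ℚ` elliptic, a number field `K`, a `ℤ₃`-extension `κ` of `K` with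
topological generator `γ`, ANY Pontryagin-dual datum `D` of `Sel_{3^∞}(E′_K/K_∞)` (its `X` is finitely generated) with
`Module.finrank Λ X ≤ 1`, any finitely generated torsion `N′` with `μ(N′) = 0`, and the specialised index inequality `hKS` for `(X_tors, N′)`
at `q_m = T^m + 3`: the conclusion of the registered stub `stub_residualCorankLeOneMultOfBeta` holds VERBATIM.
[cite: Howard2004HeegnerKolyvagin, Thm. B, proof of Thm. 2.2.10] [cite: GreenbergLNM1716, §1 p. 60] -/
theorem k2ResBound_of_card_quotSMulTop_qm_le
    (W' : WeierstrassCurve ℚ) [W'.IsElliptic] (K : Type) [Field K] [NumberField K]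
    (κ : ZpExtension K 3) (γ : Field.absoluteGaloisGroup K) [hγ : Fact (κ.IsTopGenerator γ)]
    (D : (W'.baseChange K).SelmerDualData κ γ)
    (h1 : Module.finrank (IwasawaAlgebra 3) D.X ≤ 1)
    {N' : Type*} [AddCommGroup N'] [Module (IwasawaAlgebra 3) N'] [Module.Finite (IwasawaAlgebra 3) N']
    (hN' : Module.IsTorsion (IwasawaAlgebra 3) N') (hμ' : muInvariant 3 N' = 0)
    (hKS : ∃ C m₀ : ℕ, ∀ m : ℕ, m₀ ≤ m →
      Nat.card (↥(Submodule.torsion (IwasawaAlgebra 3) D.X) ⧸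
        (Ideal.span {(PowerSeries.X ^ m + PowerSeries.C ((3 : ℕ) : ℤ_[3]) : IwasawaAlgebra 3)} • ⊤ :
          Submodule (IwasawaAlgebra 3) ↥(Submodule.torsion (IwasawaAlgebra 3) D.X))) ≤
      3 ^ C * Nat.card (N' ⧸ (Ideal.span {(PowerSeries.X ^ m + PowerSeries.C ((3 : ℕ) : ℤ_[3]) : IwasawaAlgebra 3)} • ⊤ :
          Submodule (IwasawaAlgebra 3) N')) ^ 2) :
    ∃ C : ℕ, ∀ n : ℕ,
      Nat.card {s : (W'.baseChange K).selmerInfty κ |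
        3 • s = 0 ∧ (W'.baseChange K).conjH1 3 κ.kerSubgroup (γ ^ 3 ^ n)
          (s : (W'.baseChange K).subgroupH1 3 κ.kerSubgroup) = s} ≤ 3 ^ (3 ^ n + C) := by
  haveI : (W'.baseChange K).IsElliptic := by rw [WeierstrassCurve.baseChange]; infer_instance
  haveI : Module.Finite (IwasawaAlgebra 3) D.X := D.module_finite_holds hγ.out
  exact k2ResBound_of_finrank_le_one_of_mu_eq_zero W' K κ γ D h1
    (muInvariant_torsion_eq_zero_of_card_quotSMulTop_qm_le (p := 3) hN' hμ' hKS)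

/-- **K2∣β from «`finrank ≤ 1` ∧ `hKS(X_tors, 𝔖/Λκ₁)` ∧ `loc κ₁ ∉ 3Λ`»** — the E6 form: `𝔖` finitely generated torsion-free of `Λ`-rank one
(Howard Thm. B (a)-shape), `κ₁ ∈ 𝔖` the bottom Heegner class, `loc : 𝔖 →ₗ Λ` (the localisation `loc_𝔭` after `U_𝔭 ≅ Λ`) with
`loc κ₁ ∉ 3Λ` (K1's `μ`-shadow). The conclusion of `stub_residualCorankLeOneMultOfBeta` holds VERBATIM.
[cite: Howard2004HeegnerKolyvagin, Thm. B] [cite: Castella2017HeegnerBeilinsonFlach, App. A (A.4)] -/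
theorem k2ResBound_of_card_quotSMulTop_qm_le_of_not_mem
    (W' : WeierstrassCurve ℚ) [W'.IsElliptic] (K : Type) [Field K] [NumberField K]
    (κ : ZpExtension K 3) (γ : Field.absoluteGaloisGroup K) [hγ : Fact (κ.IsTopGenerator γ)]
    (D : (W'.baseChange K).SelmerDualData κ γ)
    (h1 : Module.finrank (IwasawaAlgebra 3) D.X ≤ 1)
    {S : Type*} [AddCommGroup S] [Module (IwasawaAlgebra 3) S] [Module.Finite (IwasawaAlgebra 3) S]
    [NoZeroSMulDivisors (IwasawaAlgebra 3) S]
    (hS1 : Module.finrank (IwasawaAlgebra 3) S = 1) (κ₁ : S)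
    (loc : S →ₗ[IwasawaAlgebra 3] IwasawaAlgebra 3) (hβ : loc κ₁ ∉ augIdealP 3)
    (hKS : ∃ C m₀ : ℕ, ∀ m : ℕ, m₀ ≤ m →
      Nat.card (↥(Submodule.torsion (IwasawaAlgebra 3) D.X) ⧸
        (Ideal.span {(PowerSeries.X ^ m + PowerSeries.C ((3 : ℕ) : ℤ_[3]) : IwasawaAlgebra 3)} • ⊤ :
          Submodule (IwasawaAlgebra 3) ↥(Submodule.torsion (IwasawaAlgebra 3) D.X))) ≤
      3 ^ C * Nat.card ((S ⧸ Submodule.span (IwasawaAlgebra 3) {κ₁}) ⧸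
        (Ideal.span {(PowerSeries.X ^ m + PowerSeries.C ((3 : ℕ) : ℤ_[3]) : IwasawaAlgebra 3)} • ⊤ :
          Submodule (IwasawaAlgebra 3) (S ⧸ Submodule.span (IwasawaAlgebra 3) {κ₁}))) ^ 2) :
    ∃ C : ℕ, ∀ n : ℕ,
      Nat.card {s : (W'.baseChange K).selmerInfty κ |
        3 • s = 0 ∧ (W'.baseChange K).conjH1 3 κ.kerSubgroup (γ ^ 3 ^ n)
          (s : (W'.baseChange K).subgroupH1 3 κ.kerSubgroup) = s} ≤ 3 ^ (3 ^ n + C) := by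
  haveI : (W'.baseChange K).IsElliptic := by rw [WeierstrassCurve.baseChange]; infer_instance
  haveI : Module.Finite (IwasawaAlgebra 3) D.X := D.module_finite_holds hγ.out
  exact k2ResBound_of_finrank_le_one_of_mu_eq_zero W' K κ γ D h1
    (muInvariant_torsion_eq_zero_of_card_quotSMulTop_qm_le_of_not_mem (p := 3) hS1 κ₁ loc hβ
      hKS)

end K2

/-! ## §4 Everything read at the Eisenstein primes -/

section Specialized

open WeierstrassCurve
  Summit.BirchSwinnertonDyer.BirchSwinnertonDyer.Theorems.UniversalToricDescentEisensteinSpecializationRank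

/-- **K2∣β with BOTH inputs specialised at `q_m = T^m + 3`.** For `E′ = W′/ℚ` elliptic, a number field `K`, a `ℤ₃`-extension `κ` with
topological generator `γ`, ANY dual datum `D` of `Sel_{3^∞}(E′_K/K_∞)` (`X = D.X`, finitely generated), `𝔖` finitely generated torsion-free of
`Λ`-rank one with `κ₁ ∈ 𝔖`, `loc : 𝔖 →ₗ Λ`, `loc κ₁ ∉ 3Λ` (K1's shadow), and, at infinitely many / all large Eisenstein primes:
`hrank` — `rank_{ℤ₃} X/q_m X ≤ m + C` (Howard Thm. 1.6.1 (i)–(ii) over `S_m = Λ/q_m` after control: `X/q_m X ≈ S_m ⊕ M_m ⊕ M_m`,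
`rank_{ℤ₃} S_m = m`) — and `hKS` — `#(X_tors ⧸ q_m) ≤ 3^{C′} · #((𝔖/Λκ₁) ⧸ q_m)²` (Thm. 1.6.1 (iii) after control): the conclusion of
`stub_residualCorankLeOneMultOfBeta` holds VERBATIM (`finrank_le_one_of_lambdaInvariant_quotient_X_pow_add_C_le` + §3).
[cite: Howard2004HeegnerKolyvagin, Thm. 1.6.1, Thm. B, proof of Thm. 2.2.10] -/
theorem k2ResBound_of_specialized
    (W' : WeierstrassCurve ℚ) [W'.IsElliptic] (K : Type) [Field K] [NumberField K]
    (κ : ZpExtension K 3) (γ : Field.absoluteGaloisGroup K) [hγ : Fact (κ.IsTopGenerator γ)]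
    (D : (W'.baseChange K).SelmerDualData κ γ) (C : ℕ)
    (hrank : ∀ m₀ : ℕ, ∃ m : ℕ, m₀ ≤ m ∧
      lambdaInvariant 3 (D.X ⧸ (Ideal.span {(PowerSeries.X ^ m + PowerSeries.C ((3 : ℕ) : ℤ_[3]) : IwasawaAlgebra 3)} •
        (⊤ : Submodule (IwasawaAlgebra 3) D.X))) ≤ m + C)
    {S : Type*} [AddCommGroup S] [Module (IwasawaAlgebra 3) S] [Module.Finite (IwasawaAlgebra 3) S]
    [NoZeroSMulDivisors (IwasawaAlgebra 3) S]
    (hS1 : Module.finrank (IwasawaAlgebra 3) S = 1) (κ₁ : S)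
    (loc : S →ₗ[IwasawaAlgebra 3] IwasawaAlgebra 3) (hβ : loc κ₁ ∉ augIdealP 3)
    (hKS : ∃ C m₀ : ℕ, ∀ m : ℕ, m₀ ≤ m →
      Nat.card (↥(Submodule.torsion (IwasawaAlgebra 3) D.X) ⧸
        (Ideal.span {(PowerSeries.X ^ m + PowerSeries.C ((3 : ℕ) : ℤ_[3]) : IwasawaAlgebra 3)} • ⊤ :
          Submodule (IwasawaAlgebra 3) ↥(Submodule.torsion (IwasawaAlgebra 3) D.X))) ≤
      3 ^ C * Nat.card ((S ⧸ Submodule.span (IwasawaAlgebra 3) {κ₁}) ⧸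
        (Ideal.span {(PowerSeries.X ^ m + PowerSeries.C ((3 : ℕ) : ℤ_[3]) : IwasawaAlgebra 3)} • ⊤ :
          Submodule (IwasawaAlgebra 3) (S ⧸ Submodule.span (IwasawaAlgebra 3) {κ₁}))) ^ 2) :
    ∃ C : ℕ, ∀ n : ℕ,
      Nat.card {s : (W'.baseChange K).selmerInfty κ |
        3 • s = 0 ∧ (W'.baseChange K).conjH1 3 κ.kerSubgroup (γ ^ 3 ^ n)
          (s : (W'.baseChange K).subgroupH1 3 κ.kerSubgroup) = s} ≤ 3 ^ (3 ^ n + C) := by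
  haveI : (W'.baseChange K).IsElliptic := by rw [WeierstrassCurve.baseChange]; infer_instance
  haveI : Module.Finite (IwasawaAlgebra 3) D.X := D.module_finite_holds hγ.out
  have h1 : Module.finrank (IwasawaAlgebra 3) D.X ≤ 1 :=
    finrank_le_one_of_lambdaInvariant_quotient_X_pow_add_C_le (p := 3) C hrank
  exact k2ResBound_of_card_quotSMulTop_qm_le_of_not_mem W' K κ γ D h1 hS1 κ₁ loc hβ hKS

end Specialized

end Summit.BirchSwinnertonDyer.BirchSwinnertonDyer.Theorems.UniversalToricDescentK2BetaOfSpecializedIndex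

end
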